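import Summits.BirchSwinnertonDyer.BirchSwinnertonDyer.Theorems.GenusKolyvaginAtTwoPowDvdShaCardAtTwoRTGenusKernel
import Literature.NumberTheory.EllipticCurves.QuadraticTwistPointsOverSqrtField
import Literature.NumberTheory.EllipticCurves.BSDInvariantsProofs
import HarnessLib

/-!
# Route `GenusKolyvaginAtTwo`, LINE 18 (L_T `PowDvdShaCardAtTwoRT`, stmt-BirchSwinnertonDyer-23242): THE GENUS KERNEL OF THE TWIN —
# `H¹(F, E^{(d)}) → H¹(L, E^{(d)}_L)` is injective as soon as every point of `E(F) = E(L)^τ` is a norm from `E(L)`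

Seat `bsd-line-gk2-p2` g17 (cell `bsd-f1-sign2`), `--supports stmt-BirchSwinnertonDyer-23242` (helper; closes nothing).
THEOREMS ONLY (no definition, no named fact, no `sorry`); BSD is not proved by any of this.

WHY.  Companion of `…RTGenusKernel` (W side: `ker = {0, x_y}` on the habitat).  For the TWIN `X = E^{(d)}`, `L = F(√d)`, the twist
isomorphism `e_θ : X(L) ≃ E(L)` (tree `twistPointEquiv`, functorial with the sign rule `e_{−θ} = −e_θ`) exchanges the `τ`-eigenspaces:
`P ∈ X(L)` is ANTI-invariant iff `e_θ P ∈ E(L)` is INVARIANT, and `(τ−1)X(L)` corresponds to the NORMS `(τ+1)E(L)`.  So the genus-kernel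
criterion of `…RTGenusKernel` reads, for the twin: **`ker(H¹(F,X) → H¹(L,X_L)) = 0` as soon as every `τ`-fixed point of `E(L)` is a norm
`τR + R`** — `H¹(Gal(L/F), X(L)) = E(F)/N E(L) = Ĥ⁰(Gal(L/F), E(L))` (Kramer's twist dictionary).  On the GK2 habitat `E(L)^τ = E(ℚ)` is finite
of ODD order, so every fixed point is a norm (`Q = N(Q/2)`), and the twin side of LINE 18 has NO class dying over `K`: the `Wd`-ladder's
relaxed group `res⁻¹Ш(Wd_K)` EMBEDS into `Ш(W_K)[2^∞]^{τ = −1}` (the `c₋`/lifting term is the only genus cost on that side).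

* `map_twistPointEquiv_eq_neg` — `τ(e_θ P) = −e_θ(τP)` for `τθ = −θ`;
* **`localRestrictionKer_quadraticTwist_eq_bot_of_forall_fixed_isNorm`** — the statement above for `X = W.quadraticTwist d`;
* `localRestrictionKer_smul_eq_bot` / **`localRestrictionKer_twinModel_eq_bot_of_forall_fixed_isNorm`** — the same for any model
  `C' • W.quadraticTwist d` (e.g. the globally minimal `Wd` of LINE 18), by the tree's `galH1Equiv` transport;
* `forall_fixed_isNorm_of_odd` — fixed points killed by odd integers are norms (`Q = τ(Q′) + Q′`, `2Q′ = Q`… precisely `Q = (k+1)/2·…`: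
  if `k` is odd and `kQ = 0` then `Q = τR + R` with `R = ((k+1)/2) Q`).

References: [SilvermanAEC2009] X.2 Prop. 2.4, X.5 Cor. 5.4; [Kramer1981] §1 (eigenspaces), §3, §5 Prop. 8; [SerreLocalFields1979] VIII.§4.
-/

set_option autoImplicit false
-- the Theorems namespace of this sub repeats the summit name by design (D-0017 nested layout)
set_option linter.dupNamespace false

noncomputable section

open scoped Classical

namespace Summit.BirchSwinnertonDyer.BirchSwinnertonDyer.Theorems.GenusExact.PlusDescent

open Literature.NumberTheory.EllipticCurves WeierstrassCurve

universe u

section Twin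

variable {F : Type u} [Field F] [CharZero F] (W : WeierstrassCurve F) (L : Type u) [Field L] [Algebra F L]
  [FiniteDimensional F L]

omit [FiniteDimensional F L] in
/-- **`τ ∘ e_θ = −e_θ ∘ τ`**: for `τ ∈ Aut(L/F)` with `τθ = −θ` the twist isomorphism `e_θ : E^{(d)}(L) ≃ E(L)` anti-commutes with `τ` up
to sign (`map_twistPointEquiv` with `θ' = τθ = −θ`, then `twistPointEquiv_neg`). [cite: SilvermanAEC2009, X.2 Prop. 2.4 and X.5 Cor. 5.4] -/
theorem map_twistPointEquiv_eq_neg {C : VariableChange F} (hC : C • W = W.quadraticTwist 1) {d : F} (hd : d ≠ 0)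
    {θ : L} (hθ : θ ^ 2 = algebraMap F L d) (τ : L ≃ₐ[F] L) (hτθ : τ θ = -θ)
    (P : ((W.quadraticTwist d).baseChange L).toAffine.Point) :
    Affine.Point.map (τ : L →ₐ[F] L) (twistPointEquiv W hC hd hθ P) =
      -twistPointEquiv W hC hd hθ (Affine.Point.map (τ : L →ₐ[F] L) P) := by
  haveI : NeZero (2 : F) := ⟨two_ne_zero⟩
  have hθn : (-θ) ^ 2 = algebraMap F L d := by rw [neg_sq, hθ]
  rw [map_twistPointEquiv W hC hd hθ hθn (τ : L →ₐ[F] L) hτθ P, twistPointEquiv_neg W hC hd hθ hθn]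

/-- **The twin has no class dying over `L` when every fixed point of `E(L)` is a norm.**  `L/F` quadratic (characteristic `0`) with
non-trivial `τ`, `θ ∈ L`, `θ² = d ≠ 0`, `τθ = −θ`; if every `τ`-fixed `Q ∈ E(L)` is `τR + R` for some `R ∈ E(L)`, then
`ker(H¹(F, E^{(d)}) → H¹(L, E^{(d)}_L)) = 0`.  Proof: an anti-invariant `P ∈ E^{(d)}(L)` has `e_θ P` fixed (`map_twistPointEquiv_eq_neg`), so
`e_θ P = τR + R`, and with `R′ := e_θ⁻¹(−R)`: `τR′ − R′ = P`; conclude by `localRestrictionKer_eq_bot_of_forall_antiInvariant`.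
(`H¹(Gal(L/F), E^{(d)}(L)) = E(F)/N_{L/F} E(L)`.) [cite: Kramer1981, §1 and §5 Prop. 8] [cite: SilvermanAEC2009, X.2 Prop. 2.4] -/
theorem localRestrictionKer_quadraticTwist_eq_bot_of_forall_fixed_isNorm (h2 : Module.finrank F L = 2) (τ : L ≃ₐ[F] L)
    (hτ : τ ≠ 1) {d : F} (hd : d ≠ 0) {θ : L} (hθ : θ ^ 2 = algebraMap F L d) (hτθ : τ θ = -θ)
    (hnorm : ∀ Q : (W.baseChange L).toAffine.Point, Affine.Point.map (τ : L →ₐ[F] L) Q = Q →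
      ∃ R : (W.baseChange L).toAffine.Point, Q = Affine.Point.map (τ : L →ₐ[F] L) R + R) :
    (W.quadraticTwist d).localRestrictionKer L = ⊥ := by
  haveI : NeZero (2 : F) := ⟨two_ne_zero⟩
  obtain ⟨C, hC⟩ := exists_variableChange_quadraticTwist_one W
  set e := twistPointEquiv W hC hd hθ (L := L) with he
  have hanti : ∀ P, Affine.Point.map (τ : L →ₐ[F] L) (e P) = -e (Affine.Point.map (τ : L →ₐ[F] L) P) :=
    fun P ↦ map_twistPointEquiv_eq_neg W L hC hd hθ τ hτθ P
  refine localRestrictionKer_eq_bot_of_forall_antiInvariant (W.quadraticTwist d) L h2 τ hτ fun P hP ↦ ?_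
  -- `e P` is fixed
  have hfix : Affine.Point.map (τ : L →ₐ[F] L) (e P) = e P := by
    rw [hanti, hP, map_neg, neg_neg]
  obtain ⟨R, hR⟩ := hnorm (e P) hfix
  refine ⟨e.symm (-R), e.injective ?_⟩
  have h1 : e (Affine.Point.map (τ : L →ₐ[F] L) (e.symm (-R))) = Affine.Point.map (τ : L →ₐ[F] L) R := by
    have h := hanti (e.symm (-R))
    rw [AddEquiv.apply_symm_apply, map_neg] at h
    exact (neg_injective h).symm
  rw [map_sub, h1, AddEquiv.apply_symm_apply, hR, sub_neg_eq_add]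

omit [CharZero F] in
/-- Transport of a trivial kernel along a change of variables (`galH1Equiv`, `mem_localRestrictionKer_iff_galH1Equiv_mem`). [folklore] -/
theorem localRestrictionKer_smul_eq_bot (X : WeierstrassCurve F) (C' : VariableChange F) (E : Type u) [Field E] [Algebra F E]
    (h : X.localRestrictionKer E = ⊥) : (C' • X).localRestrictionKer E = ⊥ := by
  rw [eq_bot_iff]
  intro c hc
  rw [AddSubgroup.mem_bot]
  obtain ⟨c₀, rfl⟩ := (galH1Equiv X C').surjective c
  have h0 : c₀ ∈ X.localRestrictionKer E := (mem_localRestrictionKer_iff_galH1Equiv_mem X C' E c₀).mpr hc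
  rw [h, AddSubgroup.mem_bot] at h0
  rw [h0, map_zero]

/-- **Any model of the twin** (e.g. the globally minimal `Wd = Cd • W^{(d_K)}` of LINE 18): with the hypotheses of
`localRestrictionKer_quadraticTwist_eq_bot_of_forall_fixed_isNorm`, `ker(H¹(F, Wd) → H¹(L, Wd_L)) = 0` for `Wd = C' • W^{(d)}`.
[cite: Kramer1981, §1 and §5 Prop. 8] [cite: SilvermanAEC2009, X.5 Cor. 5.4] -/
theorem localRestrictionKer_twinModel_eq_bot_of_forall_fixed_isNorm (h2 : Module.finrank F L = 2) (τ : L ≃ₐ[F] L)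
    (hτ : τ ≠ 1) {d : F} (hd : d ≠ 0) {θ : L} (hθ : θ ^ 2 = algebraMap F L d) (hτθ : τ θ = -θ)
    {Wd : WeierstrassCurve F} (C' : VariableChange F) (hWd : C' • W.quadraticTwist d = Wd)
    (hnorm : ∀ Q : (W.baseChange L).toAffine.Point, Affine.Point.map (τ : L →ₐ[F] L) Q = Q →
      ∃ R : (W.baseChange L).toAffine.Point, Q = Affine.Point.map (τ : L →ₐ[F] L) R + R) :
    Wd.localRestrictionKer L = ⊥ := by
  subst hWd
  exact localRestrictionKer_smul_eq_bot (W.quadraticTwist d) C' L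
    (localRestrictionKer_quadraticTwist_eq_bot_of_forall_fixed_isNorm W L h2 τ hτ hd hθ hτθ hnorm)

omit [CharZero F] [FiniteDimensional F L] in
/-- **Fixed points of odd order are norms**: if `τQ = Q` and `kQ = 0` with `k` odd, then `Q = τR + R` for `R = ((k+1)/2)·Q`
(`2R = (k+1)Q = Q`).  (GK2 habitat: `E(L)^τ = E(ℚ)` is finite of odd order.) [cite: Kramer1981, §1] [cite: GrossLMS1991, §1] -/
theorem forall_fixed_isNorm_of_odd (τ : L ≃ₐ[F] L)
    (hodd : ∀ Q : (W.baseChange L).toAffine.Point, Affine.Point.map (τ : L →ₐ[F] L) Q = Q → ∃ k : ℕ, Odd k ∧ k • Q = 0) :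
    ∀ Q : (W.baseChange L).toAffine.Point, Affine.Point.map (τ : L →ₐ[F] L) Q = Q →
      ∃ R : (W.baseChange L).toAffine.Point, Q = Affine.Point.map (τ : L →ₐ[F] L) R + R := by
  intro Q hQ
  obtain ⟨k, ⟨j, rfl⟩, hkQ⟩ := hodd Q hQ
  refine ⟨(j + 1) • Q, ?_⟩
  rw [map_nsmul, hQ, ← add_nsmul]
  have h : (j + 1 + (j + 1)) • Q = (2 * j + 1) • Q + Q := by
    rw [show j + 1 + (j + 1) = (2 * j + 1) + 1 by ring, add_nsmul, one_nsmul]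
  rw [h, hkQ, zero_add]

/-- **The twin side of LINE 18 has no genus class on the habitat** (packaged): `L/F` quadratic with non-trivial `τ`, `θ² = d ≠ 0`,
`τθ = −θ`, the `τ`-fixed points of `E(L)` of odd order ⟹ `ker(H¹(F, C'•W^{(d)}) → H¹(L, ·)) = 0`.  (With `F = ℚ`, `L = K` the Heegner
field, `W(ℚ)` odd: the relaxed group `res⁻¹Ш(Wd_K)` embeds into `Ш(W_K)`.) [cite: Kramer1981, §1 and §5 Prop. 8] -/
theorem localRestrictionKer_twinModel_eq_bot_of_fixed_odd (h2 : Module.finrank F L = 2) (τ : L ≃ₐ[F] L)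
    (hτ : τ ≠ 1) {d : F} (hd : d ≠ 0) {θ : L} (hθ : θ ^ 2 = algebraMap F L d) (hτθ : τ θ = -θ)
    {Wd : WeierstrassCurve F} (C' : VariableChange F) (hWd : C' • W.quadraticTwist d = Wd)
    (hodd : ∀ Q : (W.baseChange L).toAffine.Point, Affine.Point.map (τ : L →ₐ[F] L) Q = Q → ∃ k : ℕ, Odd k ∧ k • Q = 0) :
    Wd.localRestrictionKer L = ⊥ :=
  localRestrictionKer_twinModel_eq_bot_of_forall_fixed_isNorm W L h2 τ hτ hd hθ hτθ C' hWd
    (forall_fixed_isNorm_of_odd W L τ hodd)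

end Twin

end Summit.BirchSwinnertonDyer.BirchSwinnertonDyer.Theorems.GenusExact.PlusDescent

end
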